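import Mathlib
import Literature.AlgebraicGeometry.Resolution.CohenMacaulayAvoidance
import Literature.AlgebraicGeometry.Resolution.CohenMacaulayCatenary
import Literature.AlgebraicGeometry.Resolution.CatenaryRings
import Summits.Langlands.Langlands.Theorems.SkinnerWilesDefectOneReducibleOrdinaryProModularHartshorneConnectedness

/-!
# Cohen–Macaulay local rings are connected in codimension one (Hartshorne) — the `c(A) ≥ dim A − 1`
# input of stub (R) `stub_raynaudConnectedness`, and the stub for `I = 0`

Route `SkinnerWilesDefectOne`, crux `ReducibleOrdinaryProModular` (stmt-Langlands-12919), line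
`fine-selmer-codimension-two`, registered stub (R) `stub_raynaudConnectedness` (Grothendieck /
Raynaud connectedness in crossing form for `R ≅ A ⧸ I`, `A` complete local Cohen–Macaulay,
`n + 1 + μ(I) ≤ dim A`).  Sequel of `…HartshorneConnectedness.lean` (Hartshorne's trick and the
depth-two theorem).  Sorry-free, no local cohomology:

* `Theorems.le_ringKrullDim_quotient_of_height_le_one` — in a Cohen–Macaulay local ring ("an
  `A`-regular sequence in `𝔪` of length `dim A`", verbatim as in the stub) a prime of height `≤ 1` has
  `dim A/P ≥ dim A − 1` (saturated chains have length `dim A`: tree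
  `length_eq_of_isSaturatedChain_of_isRegular`, Stacks 00N9);
* `Theorems.connectedInCodimOne_of_isCohenMacaulay` — **Hartshorne [1962, Cor. 2.4]: a Cohen–Macaulay
  local ring is connected in codimension one**, crossing form: for every two-colouring of the minimal
  primes using both colours, two minimal primes of different colours have `dim A − 1 ≤ dim A/(C₁ + C₂)`.
  Proof: otherwise the colour-class ideal `J = 𝔞^N + 𝔟^N` lies in no prime of height `≤ 1`; prime
  avoidance and Krull's principal ideal theorem give `Q₁, Q₂ ∈ J` avoiding the minimal primes of `0`
  resp. of `(Q₁)`, an `A`-regular sequence by Cohen–Macaulay avoidance (Matsumura 17.4 (iii), tree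
  `isRegular_of_forall_notMem_minimalPrimes`) — contradicting `false_of_isRegular_pair_of_colouring`;
* `Theorems.crossing_of_ringEquiv` — the crossing property is invariant under ring isomorphisms;
  `Theorems.connectedInDim_of_isCohenMacaulay` — monotonicity in `n`;
* `FineSelmerCodimensionTwo.stub_raynaudConnectedness_auxEqBot` (registered sub-goal) — the REGISTERED stub's statement,
  binders verbatim, under the extra hypothesis `I = ⊥`: this is `c(A) ≥ dim A − 1`, the hypothesis on
  `A` in Grothendieck's connectedness theorem [SGA2 XIII 2.1; Brodmann–Sharp 19.2.12] from which the
  general stub follows (`c(A/I) ≥ min(c(A), sdim A − 1) − ara(I) ≥ dim A − 1 − μ(I) ≥ n`).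

What remains of (R) after this file: Grothendieck's connectedness theorem proper for `I ≠ 0` not
generated by a regular sequence (local cohomology: Hartshorne–Lichtenbaum vanishing + Mayer–Vietoris),
not in Mathlib or the tree.

References: R. Hartshorne, *Complete intersections and connectedness*, Amer. J. Math. 84 (1962)
497–508, Prop. 1.1, Cor. 2.4 [Hartshorne1962]; M. Brodmann, R. Sharp, *Local cohomology*, CUP 1998,
12.2, 19.2.12 [BrodmannSharp1998]; A. Grothendieck, SGA 2, Exp. XIII Thm. 2.1 [Grothendieck1968SGA2];
H. Matsumura, *Commutative Ring Theory*, Thm. 17.4 [Matsumura1987]; The Stacks Project, Tag 00N9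
[StacksProject]; C. Skinner, A. Wiles, Publ. Math. IHÉS 89 (1999), App. A, Cor. A.2 [SkinnerWiles1999].
-/

set_option linter.dupNamespace false -- project-wide option (lakefile weak.linter.dupNamespace); `Summit.Langlands.Langlands` is the mandated namespace
set_option autoImplicit false

namespace Summit.Langlands.Langlands.Theorems

open IsLocalRing RingTheory.Sequence
open scoped Pointwise

universe u

variable {A : Type u} [CommRing A]

/-! ## 4. Cohen–Macaulay local rings are connected in codimension one -/

/-- A strict chain of primes starting at `P` bounds the dimension of `A ⧸ P` from below. [folklore] -/
theorem LTSeries.length_le_ringKrullDim_quotient_head (s : LTSeries (PrimeSpectrum A)) :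
    (s.length : WithBot ℕ∞) ≤ ringKrullDim (A ⧸ s.head.asIdeal) := by
  let s' : LTSeries (PrimeSpectrum.zeroLocus (R := A) (s.head.asIdeal : Set A)) :=
    LTSeries.mk s.length (fun i => ⟨s i, fun r hr =>
        (show s.head.asIdeal ≤ (s i).asIdeal from
          (PrimeSpectrum.asIdeal_le_asIdeal _ _).mpr (s.head_le i)) hr⟩)
      (fun i j hij => s.strictMono hij)
  rw [ringKrullDim_quotient]
  exact Order.LTSeries.length_le_krullDim s'

/-- **In a Cohen–Macaulay local ring a prime of height `≤ 1` has coheight `≥ dim A − 1`.**  Here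
"Cohen–Macaulay" is "an `A`-regular sequence in `𝔪` of length `dim A`" verbatim, and the proof is the
saturated-chain theorem (tree `length_eq_of_isSaturatedChain_of_isRegular`, Stacks 00N9): a saturated
chain from a minimal prime through `P` to `𝔪` has length `dim A`, and its part below `P` has length
`≤ ht P ≤ 1`. [cite: StacksProject, Tag 00N9] -/
theorem le_ringKrullDim_quotient_of_height_le_one [IsNoetherianRing A] [IsLocalRing A]
    {rs : List A} (hreg : IsRegular A rs) (hmem : ∀ r ∈ rs, r ∈ maximalIdeal A)
    (hdim : (rs.length : WithBot ℕ∞) = ringKrullDim A)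
    (P : PrimeSpectrum A) (hP : P.asIdeal.height ≤ 1) :
    ((rs.length - 1 : ℕ) : WithBot ℕ∞) ≤ ringKrullDim (A ⧸ P.asIdeal) := by
  obtain ⟨p₀, hp₀, hp₀P⟩ :=
    Ideal.exists_minimalPrimes_le (show (⊥ : Ideal A) ≤ P.asIdeal from bot_le)
  let P₀ : PrimeSpectrum A := ⟨p₀, hp₀.1.1⟩
  obtain ⟨s₁, hs₁h, hs₁l, hs₁⟩ := Literature.AlgebraicGeometry.Resolution.exists_isSaturatedChain
    (show P₀ ≤ P from (PrimeSpectrum.asIdeal_le_asIdeal P₀ P).mp hp₀P)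
  obtain ⟨s₂, hs₂h, hs₂l, hs₂⟩ := Literature.AlgebraicGeometry.Resolution.exists_isSaturatedChain
    (show P ≤ closedPoint A from
      (PrimeSpectrum.asIdeal_le_asIdeal P (closedPoint A)).mp (IsLocalRing.le_maximalIdeal P.isPrime.ne_top))
  have hconn : s₁.last = s₂.head := by rw [hs₁l, hs₂h]
  -- the concatenation is saturated from a minimal prime to `𝔪`, hence of length `dim A`
  have hlen : (s₁.smash s₂ hconn).length = rs.length :=
    Literature.AlgebraicGeometry.Resolution.length_eq_of_isSaturatedChain_of_isRegular hreg hmem hdim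
      (s₁.smash s₂ hconn) (by rw [RelSeries.head_smash, hs₁h]; exact hp₀)
      (by rw [RelSeries.last_smash, hs₂l])
      (Literature.AlgebraicGeometry.Resolution.forall_covBy_smash hconn hs₁ hs₂)
  rw [RelSeries.smash_length] at hlen
  -- `s₁.length ≤ ht P ≤ 1`
  have h1 : s₁.length ≤ 1 := by
    have h := Order.length_le_height_last (p := s₁)
    rw [hs₁l, ← PrimeSpectrum.height_eq_orderHeight] at h
    exact_mod_cast h.trans hP
  -- `s₂` is a chain above `P` of length `≥ dim A − 1`
  have h2 : rs.length - 1 ≤ s₂.length := by omega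
  have h3 := LTSeries.length_le_ringKrullDim_quotient_head s₂
  rw [hs₂h] at h3
  exact le_trans (by exact_mod_cast h2) h3

/-- Dimension only drops along surjections `A ⧸ I ↠ A ⧸ J` (`I ≤ J`). [folklore] -/
theorem ringKrullDim_quotient_anti {I J : Ideal A} (h : I ≤ J) :
    ringKrullDim (A ⧸ J) ≤ ringKrullDim (A ⧸ I) :=
  ringKrullDim_le_of_surjective (Ideal.Quotient.factor h) (Ideal.Quotient.factor_surjective h)

/-- **Hartshorne: a Cohen–Macaulay local ring is connected in codimension one** [Hartshorne 1962,
Cor. 2.4 with Prop. 1.1; Brodmann–Sharp, *Local cohomology*, 12.2 / 19.2].  Let the Noetherian local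
ring `A` admit an `A`-regular sequence in `𝔪` of length `d = dim A`.  Then for every two-colouring of
the minimal primes of `A` using both colours there are minimal primes `C₁, C₂` of different colours
with `d − 1 ≤ dim A/(C₁ + C₂)` — `c(A) ≥ dim A − 1` in crossing form, i.e. stub (R)
`stub_raynaudConnectedness` for `I = 0`, and the hypothesis on `A` in Grothendieck's connectedness
theorem [SGA2 XIII 2.1] for the general stub.  Proof: otherwise the colour-class ideal
`J = 𝔞^N + 𝔟^N` lies in no prime of height `≤ 1` (those have coheight `≥ d − 1`,
`le_ringKrullDim_quotient_of_height_le_one`); by prime avoidance and Krull's principal ideal theorem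
`J` then contains `Q₁` outside all minimal primes and `Q₂` outside all minimal primes of `(Q₁)`, an
`A`-regular sequence by the Cohen–Macaulay avoidance theorem (Matsumura 17.4 (iii), tree
`isRegular_of_forall_notMem_minimalPrimes`) — contradicting `false_of_isRegular_pair_of_colouring`.
[cite: Hartshorne1962, Cor. 2.4] -/
theorem connectedInCodimOne_of_isCohenMacaulay [IsNoetherianRing A] [IsLocalRing A]
    {rs : List A} (hreg : IsRegular A rs) (hmem : ∀ r ∈ rs, r ∈ maximalIdeal A)
    (hdim : (rs.length : WithBot ℕ∞) = ringKrullDim A)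
    (S : Set (PrimeSpectrum A)) (h₁ : ∃ C ∈ S, C.asIdeal ∈ minimalPrimes A)
    (h₂ : ∃ C ∉ S, C.asIdeal ∈ minimalPrimes A) :
    ∃ C₁ ∈ S, ∃ C₂ ∉ S, C₁.asIdeal ∈ minimalPrimes A ∧ C₂.asIdeal ∈ minimalPrimes A ∧
      ((rs.length - 1 : ℕ) : WithBot ℕ∞) ≤ ringKrullDim (A ⧸ (C₁.asIdeal ⊔ C₂.asIdeal)) := by
  classical
  by_contra H
  push Not at H
  obtain ⟨𝔞, 𝔟, h𝔞, h𝔞', h𝔟, h𝔟'⟩ := exists_colouring_ideals S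
  obtain ⟨N, hN, h0⟩ := exists_pow_mul_pow_eq_bot (mul_le_nilradical_of_colouring S h𝔞 h𝔟)
  set J : Ideal A := 𝔞 ^ N ⊔ 𝔟 ^ N with hJ
  -- every prime above `J` lies above a crossing `C₁ + C₂`, hence has coheight `< d − 1` …
  have hJcross : ∀ P : Ideal A, P.IsPrime → J ≤ P →
      ∃ C₁ ∈ S, ∃ C₂ ∉ S, C₁.asIdeal ∈ minimalPrimes A ∧ C₂.asIdeal ∈ minimalPrimes A ∧
        C₁.asIdeal ⊔ C₂.asIdeal ≤ P := by
    intro P hP hJP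
    have ha : 𝔞 ≤ P := (Ideal.IsPrime.pow_le_iff (P := P) hN.ne').mp (le_sup_left.trans hJP)
    have hb : 𝔟 ≤ P := (Ideal.IsPrime.pow_le_iff (P := P) hN.ne').mp (le_sup_right.trans hJP)
    obtain ⟨C₁, hC₁S, hC₁, hC₁P⟩ := h𝔞' P hP ha
    obtain ⟨C₂, hC₂S, hC₂, hC₂P⟩ := h𝔟' P hP hb
    exact ⟨C₁, hC₁S, C₂, hC₂S, hC₁, hC₂, sup_le hC₁P hC₂P⟩
  have hJdim : ∀ P : Ideal A, P.IsPrime → J ≤ P →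
      ringKrullDim (A ⧸ P) < ((rs.length - 1 : ℕ) : WithBot ℕ∞) := by
    intro P hP hJP
    obtain ⟨C₁, hC₁S, C₂, hC₂S, hC₁, hC₂, hle⟩ := hJcross P hP hJP
    exact lt_of_le_of_lt (ringKrullDim_quotient_anti hle) (H C₁ hC₁S C₂ hC₂S hC₁ hC₂)
  -- … so `J` lies in no prime of height `≤ 1`
  have hJht : ∀ P : PrimeSpectrum A, P.asIdeal.height ≤ 1 → ¬ J ≤ P.asIdeal := fun P hP hJP =>
    (not_le.mpr (hJdim P.asIdeal P.isPrime hJP))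
      (le_ringKrullDim_quotient_of_height_le_one hreg hmem hdim P hP)
  -- `J ≤ 𝔪`
  have hJle : J ≤ maximalIdeal A := by
    obtain ⟨C₁, hC₁S, hC₁⟩ := h₁
    obtain ⟨C₂, hC₂S, hC₂⟩ := h₂
    exact sup_le
      ((Ideal.pow_le_self hN.ne').trans ((h𝔞 C₁ hC₁S hC₁).trans
        (IsLocalRing.le_maximalIdeal C₁.isPrime.ne_top)))
      ((Ideal.pow_le_self hN.ne').trans ((h𝔟 C₂ hC₂S hC₂).trans
        (IsLocalRing.le_maximalIdeal C₂.isPrime.ne_top)))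
  -- Step 1: `Q₁ ∈ J` outside every minimal prime of `A` (prime avoidance; minimal primes have height 0)
  have hfin₀ : (minimalPrimes A).Finite := minimalPrimes.finite_of_isNoetherianRing A
  have havoid₁ : ¬ ((J : Set A) ⊆ ⋃ p ∈ (hfin₀.toFinset : Set (Ideal A)), ((p : Ideal A) : Set A)) := by
    intro hsub
    obtain ⟨p, hp, hJp⟩ := (Ideal.subset_union_prime (s := hfin₀.toFinset)
      (f := fun p : Ideal A => p) (⊥ : Ideal A) (⊥ : Ideal A)
      (fun p hp _ _ => (hfin₀.mem_toFinset.mp hp).1.1)).mp hsub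
    have hp' := hfin₀.mem_toFinset.mp hp
    haveI : p.IsPrime := hp'.1.1
    refine hJht ⟨p, hp'.1.1⟩ ?_ hJp
    rw [Ideal.height_eq_zero_iff.mpr hp']
    exact zero_le_one
  obtain ⟨Q₁, hQ₁J, hQ₁⟩ := Set.not_subset.mp havoid₁
  have hQ₁' : ∀ p ∈ minimalPrimes A, Q₁ ∉ p := by
    intro p hp hQp
    exact hQ₁ (Set.mem_iUnion₂.mpr ⟨p, hfin₀.mem_toFinset.mpr hp, hQp⟩)
  -- Step 2: `Q₂ ∈ J` outside every minimal prime of `(Q₁)` (these have height `≤ 1` by Krull)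
  have hfin₁ : (Ideal.span {Q₁}).minimalPrimes.Finite :=
    Ideal.finite_minimalPrimes_of_isNoetherianRing A _
  have havoid₂ : ¬ ((J : Set A) ⊆ ⋃ p ∈ (hfin₁.toFinset : Set (Ideal A)), ((p : Ideal A) : Set A)) := by
    intro hsub
    obtain ⟨p, hp, hJp⟩ := (Ideal.subset_union_prime (s := hfin₁.toFinset)
      (f := fun p : Ideal A => p) (⊥ : Ideal A) (⊥ : Ideal A)
      (fun p hp _ _ => (hfin₁.mem_toFinset.mp hp).1.1)).mp hsub
    have hp' := hfin₁.mem_toFinset.mp hp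
    refine hJht ⟨p, hp'.1.1⟩ ?_ hJp
    exact Ideal.height_le_one_of_isPrincipal_of_mem_minimalPrimes (Ideal.span {Q₁}) p hp'
  obtain ⟨Q₂, hQ₂J, hQ₂⟩ := Set.not_subset.mp havoid₂
  have hQ₂' : ∀ p ∈ (Ideal.span {Q₁}).minimalPrimes, Q₂ ∉ p := by
    intro p hp hQp
    exact hQ₂ (Set.mem_iUnion₂.mpr ⟨p, hfin₁.mem_toFinset.mpr hp, hQp⟩)
  -- Step 3: `Q₁, Q₂` is an `A`-regular sequence (Cohen–Macaulay avoidance)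
  have hQm : ∀ q ∈ [Q₁, Q₂], q ∈ maximalIdeal A := by
    intro q hq
    simp only [List.mem_cons, List.not_mem_nil, or_false] at hq
    rcases hq with rfl | rfl
    · exact hJle hQ₁J
    · exact hJle hQ₂J
  have havoid : Literature.AlgebraicGeometry.Resolution.AvoidsMinimalPrimes [Q₁, Q₂] := by
    intro L₁ q L₂ hdec p hp
    match L₁, hdec with
    | [], hdec =>
      simp only [List.nil_append, List.cons.injEq] at hdec
      obtain ⟨rfl, -⟩ := hdec
      refine hQ₁' p ?_
      simpa [Ideal.ofList, minimalPrimes] using hp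
    | [a], hdec =>
      simp only [List.cons_append, List.nil_append, List.cons.injEq] at hdec
      obtain ⟨rfl, rfl, -⟩ := hdec
      refine hQ₂' p ?_
      simpa [Ideal.ofList] using hp
    | a :: b :: L, hdec =>
      exfalso
      have := congrArg List.length hdec
      simp at this
  have hregQ : IsRegular A [Q₁, Q₂] :=
    Literature.AlgebraicGeometry.Resolution.isRegular_of_forall_notMem_minimalPrimes hreg hmem hdim
      hQm havoid
  -- Step 4: contradiction with Hartshorne's trick
  exact false_of_isRegular_pair_of_colouring S h₁ h₂ h𝔞' h𝔟' hN h0 hregQ hQ₁J hQ₂J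

/-! ## 5. Transport of the crossing property along ring isomorphisms -/

/-- **Connectedness in dimension `n` (crossing form) is invariant under ring isomorphisms.**
[folklore] -/
theorem crossing_of_ringEquiv {R : Type u} {R' : Type*} [CommRing R] [CommRing R']
    (e : R ≃+* R') (n : WithBot ℕ∞)
    (h : ∀ S' : Set (PrimeSpectrum R'), (∃ C ∈ S', C.asIdeal ∈ minimalPrimes R') →
      (∃ C ∉ S', C.asIdeal ∈ minimalPrimes R') →
        ∃ C₁ ∈ S', ∃ C₂ ∉ S', C₁.asIdeal ∈ minimalPrimes R' ∧ C₂.asIdeal ∈ minimalPrimes R' ∧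
          n ≤ ringKrullDim (R' ⧸ (C₁.asIdeal ⊔ C₂.asIdeal)))
    (S : Set (PrimeSpectrum R)) (h₁ : ∃ C ∈ S, C.asIdeal ∈ minimalPrimes R)
    (h₂ : ∃ C ∉ S, C.asIdeal ∈ minimalPrimes R) :
    ∃ C₁ ∈ S, ∃ C₂ ∉ S, C₁.asIdeal ∈ minimalPrimes R ∧ C₂.asIdeal ∈ minimalPrimes R ∧
      n ≤ ringKrullDim (R ⧸ (C₁.asIdeal ⊔ C₂.asIdeal)) := by
  -- `φ = Spec(e) : Spec R' → Spec R`, `P' ↦ e⁻¹(P')`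
  let φ : PrimeSpectrum R' → PrimeSpectrum R := PrimeSpectrum.comap (e : R →+* R')
  have hφ : ∀ P' : PrimeSpectrum R', (φ P').asIdeal = P'.asIdeal.comap (e : R →+* R') := fun _ => rfl
  -- minimal primes correspond
  have hmin : minimalPrimes R = Ideal.comap (e : R →+* R') '' minimalPrimes R' := by
    have h0 := Ideal.comap_minimalPrimes_eq_of_surjective (f := (e : R →+* R')) e.surjective ⊥
    rwa [← RingHom.ker_eq_comap_bot, show RingHom.ker (e : R →+* R') = ⊥ from
      (RingHom.injective_iff_ker_eq_bot _).mp e.injective] at h0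
  have hmin' : ∀ P' : PrimeSpectrum R', P'.asIdeal ∈ minimalPrimes R' →
      (φ P').asIdeal ∈ minimalPrimes R := fun P' hP' => by
    rw [hφ, hmin]; exact ⟨_, hP', rfl⟩
  have hmin'' : ∀ C : PrimeSpectrum R, C.asIdeal ∈ minimalPrimes R →
      ∃ P' : PrimeSpectrum R', P'.asIdeal ∈ minimalPrimes R' ∧ φ P' = C := fun C hC => by
    rw [hmin] at hC
    obtain ⟨p', hp', hp'C⟩ := hC
    exact ⟨⟨p', hp'.1.1⟩, hp', PrimeSpectrum.ext hp'C⟩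
  -- pull the colouring back to `Spec R'`
  set S' : Set (PrimeSpectrum R') := φ ⁻¹' S with hS'
  have h₁' : ∃ C ∈ S', C.asIdeal ∈ minimalPrimes R' := by
    obtain ⟨C, hCS, hC⟩ := h₁
    obtain ⟨P', hP', rfl⟩ := hmin'' C hC
    exact ⟨P', hCS, hP'⟩
  have h₂' : ∃ C ∉ S', C.asIdeal ∈ minimalPrimes R' := by
    obtain ⟨C, hCS, hC⟩ := h₂
    obtain ⟨P', hP', rfl⟩ := hmin'' C hC
    exact ⟨P', hCS, hP'⟩
  obtain ⟨C₁, hC₁S, C₂, hC₂S, hC₁, hC₂, hdim⟩ := h S' h₁' h₂'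
  refine ⟨φ C₁, hC₁S, φ C₂, hC₂S, hmin' C₁ hC₁, hmin' C₂ hC₂, ?_⟩
  -- `R ⧸ (e⁻¹C₁ + e⁻¹C₂) ≃ R' ⧸ (C₁ + C₂)`
  have hmap : (φ C₁).asIdeal ⊔ (φ C₂).asIdeal = (C₁.asIdeal ⊔ C₂.asIdeal).map (e.symm : R' →+* R) := by
    rw [hφ, hφ, Ideal.map_sup, Ideal.map_comap_of_equiv, Ideal.map_comap_of_equiv,
      RingEquiv.symm_symm]
    try rfl
  have eq : R' ⧸ (C₁.asIdeal ⊔ C₂.asIdeal) ≃+* R ⧸ ((φ C₁).asIdeal ⊔ (φ C₂).asIdeal) :=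
    Ideal.quotientEquiv _ _ e.symm hmap
  rwa [← ringKrullDim_eq_of_ringEquiv eq]

/-- **`c(A) ≥ dim A − 1` ⟹ connected in every dimension `n ≤ dim A − 1`** (monotonicity in `n`,
recorded in the shape used by the stubs). [folklore] -/
theorem connectedInDim_of_isCohenMacaulay [IsNoetherianRing A] [IsLocalRing A]
    {rs : List A} (hreg : IsRegular A rs) (hmem : ∀ r ∈ rs, r ∈ maximalIdeal A)
    (hdim : (rs.length : WithBot ℕ∞) = ringKrullDim A) (n : ℕ) (hn : n + 1 ≤ rs.length)
    (S : Set (PrimeSpectrum A)) (h₁ : ∃ C ∈ S, C.asIdeal ∈ minimalPrimes A)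
    (h₂ : ∃ C ∉ S, C.asIdeal ∈ minimalPrimes A) :
    ∃ C₁ ∈ S, ∃ C₂ ∉ S, C₁.asIdeal ∈ minimalPrimes A ∧ C₂.asIdeal ∈ minimalPrimes A ∧
      (n : WithBot ℕ∞) ≤ ringKrullDim (A ⧸ (C₁.asIdeal ⊔ C₂.asIdeal)) := by
  obtain ⟨C₁, hC₁S, C₂, hC₂S, hC₁, hC₂, hle⟩ :=
    connectedInCodimOne_of_isCohenMacaulay hreg hmem hdim S h₁ h₂
  refine ⟨C₁, hC₁S, C₂, hC₂S, hC₁, hC₂, le_trans ?_ hle⟩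
  exact_mod_cast (show n ≤ rs.length - 1 by omega)

end Summit.Langlands.Langlands.Theorems

/-! ## 6. The registered sub-goals (verbatim signatures) -/

namespace Summit.Langlands.Langlands.Cruxes.ReducibleOrdinaryProModular.FineSelmerCodimensionTwo

open IsLocalRing RingTheory.Sequence

/-- **Registered sub-goal `stub_raynaudConnectedness_auxCodimOne` of stub (R)
`stub_raynaudConnectedness`**: Hartshorne's "Cohen–Macaulay local rings are connected in codimension
one" in crossing form, `Theorems.connectedInCodimOne_of_isCohenMacaulay` at universe `0` — stub (R) for
`I = 0` on the nose of `A`, and the `c(A) ≥ dim A − 1` input of SGA2 XIII 2.1.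
[cite: Hartshorne1962, Cor. 2.4] -/
theorem stub_raynaudConnectedness_auxCodimOne :
    ∀ (A : Type) [CommRing A] [IsNoetherianRing A] [IsLocalRing A] (rs : List A),
      (∀ r ∈ rs, r ∈ IsLocalRing.maximalIdeal A) → RingTheory.Sequence.IsRegular A rs →
      (rs.length : WithBot ℕ∞) = ringKrullDim A →
      ∀ S : Set (PrimeSpectrum A), (∃ C ∈ S, C.asIdeal ∈ minimalPrimes A) →
        (∃ C ∉ S, C.asIdeal ∈ minimalPrimes A) →
          ∃ C₁ ∈ S, ∃ C₂ ∉ S, C₁.asIdeal ∈ minimalPrimes A ∧ C₂.asIdeal ∈ minimalPrimes A ∧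
            ((rs.length - 1 : ℕ) : WithBot ℕ∞) ≤ ringKrullDim (A ⧸ (C₁.asIdeal ⊔ C₂.asIdeal)) :=
  fun _ _ _ _ _ hmem hreg hdim S h₁ h₂ =>
    Summit.Langlands.Langlands.Theorems.connectedInCodimOne_of_isCohenMacaulay hreg hmem hdim S h₁ h₂


/-- **Registered sub-goal `stub_raynaudConnectedness_auxEqBot` = stub (R) `stub_raynaudConnectedness` for `I = 0`**: with the registered binders verbatim and the
extra hypothesis `I = ⊥` (so `R ≃ A`, Cohen–Macaulay), the crossing conclusion holds — Hartshorne's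
"Cohen–Macaulay local rings are connected in codimension one" (`connectedInCodimOne_of_isCohenMacaulay`)
transported along `R ≃+* A ⧸ ⊥ ≃+* A`.  The completeness hypothesis is not used.  This is the
`c(A) ≥ dim A − 1` input of Grothendieck's connectedness theorem [SGA2 XIII 2.1] for the general stub.
[cite: Hartshorne1962, Cor. 2.4] -/
theorem stub_raynaudConnectedness_auxEqBot :
    ∀ (R : Type) [CommRing R] (A : Type) [CommRing A] [IsNoetherianRing A] [IsLocalRing A]
      [IsAdicComplete (IsLocalRing.maximalIdeal A) A] (rs : List A),
      (∀ r ∈ rs, r ∈ IsLocalRing.maximalIdeal A) → RingTheory.Sequence.IsRegular A rs →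
      (rs.length : WithBot ℕ∞) = ringKrullDim A →
      ∀ (I : Ideal A) (_ : R ≃+* A ⧸ I) (n : ℕ), ((n + 1 : ℕ) : WithBot ℕ∞) + I.spanFinrank ≤ ringKrullDim A →
      I = ⊥ →
      ∀ S : Set (PrimeSpectrum R),
        (∃ C ∈ S, C.asIdeal ∈ minimalPrimes R) → (∃ C ∉ S, C.asIdeal ∈ minimalPrimes R) →
          ∃ C₁ ∈ S, ∃ C₂ ∉ S, C₁.asIdeal ∈ minimalPrimes R ∧ C₂.asIdeal ∈ minimalPrimes R ∧
            (n : WithBot ℕ∞) ≤ ringKrullDim (R ⧸ (C₁.asIdeal ⊔ C₂.asIdeal)) := by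
  intro R _ A _ _ _ _ rs hmem hreg hdim I e n hle hI S h₁ h₂
  subst hI
  -- `R ≃ A`
  let e' : R ≃+* A := e.trans (RingEquiv.quotientBot A)
  -- `n + 1 ≤ dim A = rs.length`
  have hn : n + 1 ≤ rs.length := by
    have h1 : ((n + 1 : ℕ) : WithBot ℕ∞) ≤ ((n + 1 : ℕ) : WithBot ℕ∞) + (⊥ : Ideal A).spanFinrank :=
      le_add_of_nonneg_right (by exact_mod_cast Nat.zero_le _)
    have h2 := (h1.trans hle).trans_eq hdim.symm
    exact_mod_cast h2
  exact Summit.Langlands.Langlands.Theorems.crossing_of_ringEquiv e' n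
    (fun S' h₁' h₂' => Summit.Langlands.Langlands.Theorems.connectedInDim_of_isCohenMacaulay
      hreg hmem hdim n hn S' h₁' h₂') S h₁ h₂

end Summit.Langlands.Langlands.Cruxes.ReducibleOrdinaryProModular.FineSelmerCodimensionTwo
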